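import Mathlib.LinearAlgebra.FreeModule.ModN
import Mathlib.LinearAlgebra.FreeModule.PID
import Mathlib.GroupTheory.FiniteAbelian.Basic
import Mathlib.GroupTheory.Index
import Mathlib.Algebra.Exact.Basic
import Mathlib.Algebra.Module.Torsion.Basic
import Mathlib.Data.Nat.Prime.Infinite
import HarnessLib

/-!
# A finitely generated abelian group with `|G/nG| = n^d` for all `n` is free of rank `d`

Topic `Literature/GroupTheory/FiniteAbelian`. Everything here is PROVED; no named fact is
introduced. Written for the fact seat of
`Literature.AlgebraicGeometry.Motives.two_mul_dim_eq_finrank_bettiCohomology`: there the lattice is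
`Λ = H₁(A(ℂ); ℤ)` for a complex abelian variety `A` of dimension `g`, and `|Λ/nΛ| = |A[n](ℂ)| = n^{2g}`
comes from the covering `x ↦ nx` of `A(ℂ)` (Mumford, *Abelian Varieties*, §1 (3) and §4 p. 42);
the conclusion `Λ ≅ ℤ^{2g}` is Mumford's "`H₁(X, ℤ) ≅ U`, a lattice".

* `natCard_modN_eq_of_linearEquiv_prod` — `|N/nN| = |T/nT| · |F/nF|` for `N ≃ T × F`
  (indices multiply over products, Mathlib `AddSubgroup.index_prod`).
* `free_and_finrank_eq_of_natCard_modN` — **the lemma**: if `M` is a finitely generated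
  `ℤ`-module and `|M/nM| = n^d` for every `n ≥ 1`, then `M` is free of rank `d`. Proof: `M ≅ T × F`
  with `T` the (finite) torsion subgroup and `F = M/T` free of rank `r` (structure of finitely
  generated modules over the PID `ℤ`; the projection splits because `F` is projective); for a prime
  `p > |T|`, multiplication by `p` is bijective on `T`, so `p^d = |M/pM| = |F/pF| = p^r` and `r = d`;
  for `n = |T|`, `nT = 0`, so `n^d = |M/nM| = |T| · n^r = n^{d+1}`, forcing `|T| = 1`; hence `M` is
  torsion-free, i.e. free, of rank `d`. (Elementary; e.g. the invariants `|G/pG| = p^{rank + #(p-primary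
  cyclic factors)}` of the fundamental theorem of finitely generated abelian groups.) [folklore]

## References

* D. Mumford, *Abelian Varieties* (1970), §1 (3). [MumfordAV1970]
-/

noncomputable section

open Function

universe u v

namespace Literature.GroupTheory.FiniteAbelian

/-! ### `|N/nN|` as an index; products -/

section Index

variable {N : Type u} [AddCommGroup N]

/-- `|N/nN|` is the index of the subgroup `nN` of `n`-th multiples. [folklore] -/
theorem natCard_modN_eq_index (n : ℕ) :
    Nat.card (ModN N n) = (LinearMap.range (LinearMap.lsmul ℤ N n)).toAddSubgroup.index :=
  rfl

/-- The subgroup `nN` is carried to `nN'` by any additive isomorphism. [folklore] -/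
theorem map_range_lsmul_eq {N' : Type v} [AddCommGroup N'] (e : N ≃+ N') (n : ℕ) :
    (LinearMap.range (LinearMap.lsmul ℤ N n)).toAddSubgroup.map (e : N →+ N') =
      (LinearMap.range (LinearMap.lsmul ℤ N' n)).toAddSubgroup := by
  ext y
  simp only [AddSubgroup.mem_map, Submodule.mem_toAddSubgroup, LinearMap.mem_range,
    LinearMap.lsmul_apply, AddMonoidHom.coe_coe]
  constructor
  · rintro ⟨x, ⟨z, rfl⟩, rfl⟩
    exact ⟨e z, by rw [map_zsmul]⟩
  · rintro ⟨z, rfl⟩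
    exact ⟨(n : ℤ) • e.symm z, ⟨e.symm z, rfl⟩, by rw [map_zsmul, AddEquiv.apply_symm_apply]⟩

/-- `|N/nN|` is invariant under additive isomorphisms. [folklore] -/
theorem natCard_modN_congr {N' : Type v} [AddCommGroup N'] (e : N ≃+ N') (n : ℕ) :
    Nat.card (ModN N n) = Nat.card (ModN N' n) := by
  rw [natCard_modN_eq_index, natCard_modN_eq_index, ← map_range_lsmul_eq e n,
    AddSubgroup.index_map_of_bijective (f := (e : N →+ N')) e.bijective]

/-- **`|N/nN| = |T/nT| · |F/nF|` for `N = T × F`** (the subgroup of `n`-th multiples of a product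
is the product of the subgroups of `n`-th multiples, and indices multiply, Mathlib
`AddSubgroup.index_prod`). [folklore] -/
theorem natCard_modN_prod {T : Type u} {F : Type v} [AddCommGroup T] [AddCommGroup F] (n : ℕ) :
    Nat.card (ModN (T × F) n) = Nat.card (ModN T n) * Nat.card (ModN F n) := by
  rw [natCard_modN_eq_index, natCard_modN_eq_index, natCard_modN_eq_index,
    ← AddSubgroup.index_prod]
  congr 1
  ext ⟨a, b⟩
  simp only [Submodule.mem_toAddSubgroup, LinearMap.mem_range, LinearMap.lsmul_apply,
    AddSubgroup.mem_prod, Prod.exists, Prod.smul_mk, Prod.mk.injEq]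
  constructor
  · rintro ⟨x, y, rfl, rfl⟩
    exact ⟨⟨x, rfl⟩, ⟨y, rfl⟩⟩
  · rintro ⟨⟨x, rfl⟩, ⟨y, rfl⟩⟩
    exact ⟨x, y, rfl, rfl⟩

/-- If multiplication by `n` kills `N`, then `|N/nN| = |N|`. [folklore] -/
theorem natCard_modN_of_smul_eq_zero (n : ℕ) (h : ∀ x : N, (n : ℤ) • x = 0) :
    Nat.card (ModN N n) = Nat.card N := by
  have hbot : (LinearMap.range (LinearMap.lsmul ℤ N n)).toAddSubgroup = ⊥ := by
    rw [eq_bot_iff]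
    rintro y ⟨x, rfl⟩
    exact h x
  rw [natCard_modN_eq_index, hbot, AddSubgroup.index_bot]

/-- If multiplication by `n` is onto, then `|N/nN| = 1`. [folklore] -/
theorem natCard_modN_of_smul_surjective (n : ℕ) (h : Surjective fun x : N ↦ (n : ℤ) • x) :
    Nat.card (ModN N n) = 1 := by
  have htop : (LinearMap.range (LinearMap.lsmul ℤ N n)).toAddSubgroup = ⊤ := by
    rw [eq_top_iff]
    rintro y -
    obtain ⟨x, rfl⟩ := h y
    exact ⟨x, rfl⟩
  rw [natCard_modN_eq_index, htop, AddSubgroup.index_top]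

end Index

/-! ### Splitting off the torsion -/

section Torsion

variable (M : Type u) [AddCommGroup M] [Module.Finite ℤ M]

/-- The torsion subgroup of a finitely generated abelian group is finite. [folklore] -/
theorem finite_torsion : Finite (Submodule.torsion ℤ M) := by
  haveI : IsNoetherian ℤ M := isNoetherian_of_isNoetherianRing_of_finite ℤ M
  haveI : Module.Finite ℤ (Submodule.torsion ℤ M) := Module.IsNoetherian.finite ℤ _
  refine Module.finite_of_fg_torsion (Submodule.torsion ℤ M) fun x ↦ ?_
  obtain ⟨a, hax⟩ := x.2
  exact ⟨a, Subtype.ext (by simpa using hax)⟩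

/-- **A finitely generated abelian group is the product of its torsion subgroup and a free group**:
`M ≃ T × (M/T)` with `T = M_tors` finite and `M/T` torsion-free, hence free (structure theorem over
the PID `ℤ`; the surjection `M → M/T` splits because `M/T` is projective). [folklore] -/
theorem nonempty_linearEquiv_torsion_prod :
    Nonempty (M ≃ₗ[ℤ] Submodule.torsion ℤ M × (M ⧸ Submodule.torsion ℤ M)) := by
  set T := Submodule.torsion ℤ M
  haveI : Module.Finite ℤ (M ⧸ T) := Module.Finite.quotient ℤ T
  haveI : Module.IsTorsionFree ℤ (M ⧸ T) := Submodule.QuotientTorsion.instIsTorsionFree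
  haveI : Module.Free ℤ (M ⧸ T) := Module.free_of_finite_type_torsion_free'
  obtain ⟨s, hs⟩ := Module.projective_lifting_property T.mkQ (LinearMap.id : (M ⧸ T) →ₗ[ℤ] M ⧸ T)
    T.mkQ_surjective
  exact ⟨((LinearMap.exact_subtype_mkQ T).splitSurjectiveEquiv T.injective_subtype ⟨s, hs⟩).1⟩

end Torsion

/-! ### The lemma -/

/-- **A finitely generated abelian group `M` with `|M/nM| = n^d` for all `n ≥ 1` is free of rank
`d`.** Write `M ≅ T × F`, `T` the finite torsion subgroup, `F = M/T` free of rank `r`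
(`nonempty_linearEquiv_torsion_prod`), so `|M/nM| = |T/nT| · n^r` (`natCard_modN_prod`,
Mathlib `ModN.natCard_eq`). For a prime `p > |T|` multiplication by `p` is injective on `T`
(the order of a `p`-torsion element divides `gcd(p, |T|) = 1`), hence bijective, so `|T/pT| = 1`
and `p^d = p^r`: `r = d`. For `n = |T|`, `nT = 0`, so `|T/nT| = |T|` and `n^d = |T| · n^d`: `|T| = 1`.
So `M` is torsion-free, hence free, and `|M/pM| = p^{rank M}` gives `rank M = d`. [folklore] -/
theorem free_and_finrank_eq_of_natCard_modN {M : Type u} [AddCommGroup M] [Module.Finite ℤ M]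
    (d : ℕ) (h : ∀ n : ℕ, 0 < n → Nat.card (ModN M n) = n ^ d) :
    Module.Free ℤ M ∧ Module.finrank ℤ M = d := by
  set T := Submodule.torsion ℤ M with hT
  haveI hTfin : Finite T := finite_torsion M
  haveI : Module.Finite ℤ (M ⧸ T) := Module.Finite.quotient ℤ T
  haveI : Module.IsTorsionFree ℤ (M ⧸ T) := Submodule.QuotientTorsion.instIsTorsionFree
  haveI : Module.Free ℤ (M ⧸ T) := Module.free_of_finite_type_torsion_free'
  obtain ⟨e⟩ := nonempty_linearEquiv_torsion_prod M
  set r := Module.finrank ℤ (M ⧸ T) with hr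
  -- `|M/nM| = |T/nT| · n^r`
  have hcount : ∀ n : ℕ, 0 < n → Nat.card (ModN T n) * n ^ r = n ^ d := fun n hn ↦ by
    haveI : NeZero n := ⟨hn.ne'⟩
    rw [← h n hn, natCard_modN_congr e.toAddEquiv n, natCard_modN_prod, ModN.natCard_eq (M ⧸ T) n]
  -- orders of elements of `T` divide `|T|`
  set t := Nat.card T with ht
  have ht0 : 0 < t := Nat.card_pos
  -- Step 1: a prime `p > |T|`: multiplication by `p` is bijective on `T`, so `r = d`
  obtain ⟨p, htp, hp⟩ := Nat.exists_infinite_primes (t + 1)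
  have hpt : Nat.Coprime p t :=
    hp.coprime_iff_not_dvd.2 (Nat.not_dvd_of_pos_of_lt ht0 (by omega))
  have hzero : ∀ x : T, (p : ℤ) • x = 0 → x = 0 := fun x hx ↦ by
    have h1 : addOrderOf x ∣ p := by
      rw [addOrderOf_dvd_iff_nsmul_eq_zero, ← natCast_zsmul]
      exact hx
    have h2 : addOrderOf x ∣ t := addOrderOf_dvd_natCard x
    have h3 : addOrderOf x ∣ 1 := hpt ▸ Nat.dvd_gcd h1 h2
    exact AddMonoid.addOrderOf_eq_one_iff.mp (Nat.dvd_one.mp h3)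
  have hinj : Injective fun x : T ↦ (p : ℤ) • x := fun x y hxy ↦ by
    have : (p : ℤ) • (x - y) = 0 := by rw [smul_sub, sub_eq_zero]; exact hxy
    exact sub_eq_zero.mp (hzero _ this)
  have hsurj : Surjective fun x : T ↦ (p : ℤ) • x := Finite.surjective_of_injective hinj
  have hrd : r = d := by
    have h1 := hcount p hp.pos
    rw [natCard_modN_of_smul_surjective p hsurj, one_mul] at h1
    exact Nat.pow_right_injective hp.two_le h1
  -- Step 2: `n = |T|` kills `T`, so `|T| · |T|^d = |T|^d` and `|T| = 1`
  have ht1 : t = 1 := by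
    have hkill : ∀ x : T, (t : ℤ) • x = 0 := fun x ↦ by
      rw [natCast_zsmul]
      exact card_nsmul_eq_zero'
    have h1 := hcount t ht0
    rw [natCard_modN_of_smul_eq_zero t hkill, hrd] at h1
    exact (mul_eq_right₀ (pow_ne_zero d ht0.ne')).mp h1
  -- Step 3: `T = 0`, so `M` is torsion-free, hence free, and `|M/pM| = p^{rank M}` gives the rank
  have hTbot : T = ⊥ := by
    have hsub : Subsingleton T := (Nat.card_eq_one_iff_unique.mp ht1).1
    rw [eq_bot_iff]
    intro x hx
    have := Subsingleton.elim (⟨x, hx⟩ : T) 0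
    simpa using congrArg Subtype.val this
  haveI : Module.IsTorsionFree ℤ M := Submodule.isTorsionFree_iff_torsion_eq_bot.mpr hTbot
  haveI hfree : Module.Free ℤ M := Module.free_of_finite_type_torsion_free'
  refine ⟨hfree, ?_⟩
  haveI : NeZero p := ⟨hp.ne_zero⟩
  have h1 := h p hp.pos
  rw [ModN.natCard_eq] at h1
  exact Nat.pow_right_injective hp.two_le h1

/-- The same, packaged as an isomorphism with `ℤ^d`. [folklore] -/
theorem nonempty_linearEquiv_of_natCard_modN {M : Type u} [AddCommGroup M] [Module.Finite ℤ M]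
    (d : ℕ) (h : ∀ n : ℕ, 0 < n → Nat.card (ModN M n) = n ^ d) :
    Nonempty ((Fin d → ℤ) ≃ₗ[ℤ] M) := by
  obtain ⟨hfree, hrank⟩ := free_and_finrank_eq_of_natCard_modN d h
  exact ⟨(Module.finBasisOfFinrankEq ℤ M hrank).equivFun.symm⟩

/-- The same, as an isomorphism of abelian groups with `ℤ^d` (convenient when `M` carries a
`ℤ`-module structure not syntactically the canonical one: use `AddEquiv.toIntLinearEquiv`). [folklore] -/
theorem nonempty_addEquiv_of_natCard_modN {M : Type u} [AddCommGroup M] [Module.Finite ℤ M]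
    (d : ℕ) (h : ∀ n : ℕ, 0 < n → Nat.card (ModN M n) = n ^ d) :
    Nonempty ((Fin d → ℤ) ≃+ M) :=
  let ⟨e⟩ := nonempty_linearEquiv_of_natCard_modN d h
  ⟨e.toAddEquiv⟩

end Literature.GroupTheory.FiniteAbelian

end
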